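import Summits.QuantumFields.BalabanUV.Beta.EriceFlowEnclosureB12AsPrintedPointwiseFadingLimit
import Summits.QuantumFields.BalabanUV.Beta.EriceFlowEnclosureB12AsPrintedHistoryContagionShiftFlowZero

/-!
# Beta / EriceFlowEnclosureB12AsPrintedPointwiseFadingLimitZeroJunction — WHAT (0.31) FORCES, part 11h: ONE NUMBER, TWO ROUTES (junction with prover 1's part 32).  The two β-flow provers
# reached the value at zero coupling the same hour by different routes: prover 1 (`…HistoryContagionShiftFlowZero`, part 32) for an ABSTRACT fading-memory functional `B` — a number β₀ with the
# LETTER `|B u − β₀| ≤ C_m·Σ'_j θ^j u_j` on every box history (`exists_valueAtZero`, `valueAtZero_unique`, `abs_sub_valueAtZero_le`); prover 2 (`…PointwiseFadingLimit`, part 11) for the LATTICE family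
# `β : HBeta` under node U2's moduli + NE4 — a number b⋆ with `|betaInf β (u,u,…) − b⋆| ≤ Cu∕(1−θ)` on the constant histories (`exists_bstar`, `bstar_unique`) and the scale-resolved sandwich.  This file
# records that for `B := betaInf β` (node U2's stationary functional, `MemoryProfile C θ γ (betaInf β)` by `memoryProfile_betaInf`) THE TWO NUMBERS COINCIDE: §1 prover 1's letter restricted to
# the constant histories IS prover 2's displayed property (`hb_of_valueAtZero`), hence **`valueAtZero_eq_bstar`** (`β₀ = b⋆`), and conversely b⋆ satisfies prover 1's full letter
# (**`valueAtZero_letter_bstar`**) — so every consequence either lineage attaches to its number (part 32's clock `m·t(m)² → 1∕β₀`, one-loop law and relative Λ on node U2's trajectories; part 11's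
# sandwich, `isLUB_floors`, `slopes_straddle_bstar`, sharp (0.31), bare-coupling clock `K·g₀(K)² → 1∕b⋆`, one-loop coefficients `β⁰ → b⋆`) is a statement about THE SAME real number
# (β-flow team, prover 2 = lower ∕ positivity side, unit `b2b-balaban-beta-bflow-p2`, gen 49; junction with unit `b2b-balaban-beta-bflow-p1` gen 39 part 32, BY NAME, nothing of theirs restated or modified)

HONEST FRAMING (page 1 of everything the β sub-cell writes): discharging `BetaPertH` makes Bałaban's UV stability UNCONDITIONAL — a
real constructive-QFT result; it is NOT the continuum limit and NOT the Clay problem.  HONEST DEPENDENCY (cell reorg 2026-08-19,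
verbatim): «continuum YM on T⁴ ⇐ BetaPertH ∧ nine spine estimates (0/9 proved); BetaPertH ⇐ (D1) ∧ (D4) ∧ CAP+tail; G-an2-4 gates
asym, D1 and NE2/3/4.»  THIS MODULE DISCHARGES NOTHING: bookkeeping BY NAME over prover 1's `…ShiftFlowZero.{exists_valueAtZero, abs_sub_valueAtZero_le}`, node U2's `T4BetaStationary.memoryProfile_betaInf`
and part 11's `bstar_unique` ∕ `seqBox_const`, under node U2's HYPOTHESIS SHAPES `HistLipschitz ∕ FadingMemory ∕ ScaleShiftRate` (NOT printed: [Balaban1987RG1] = T. Bałaban, Commun. Math. Phys. **109** (1987)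
p. 298 ∕ p. 264; GAPS G-t4-U2-1∕2).  β₀ and b⋆ are reals with displayed properties; nothing of Bałaban's (1.22) is asserted.

WHAT THIS FILE PROVES (0 sorry, 0 def): `hb_of_valueAtZero`, **`valueAtZero_eq_bstar`**, **`valueAtZero_letter_bstar`**, `exists_common_value`.
NOT CLAIMED: any letter for Bałaban's β; Theorem 2; `BetaPertH`; continuum; Clay.
-/

namespace Summit.QuantumFields.BalabanUV.Beta.EriceFlowEnclosureB12AsPrintedPointwiseFadingLimitZeroJunction

open Finset Filter Topology
open Literature.MathematicalPhysics.QuantumFieldTheory.Balaban1983to89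
open Literature.MathematicalPhysics.QuantumFieldTheory.Balaban1983to89.FlowStep (HBeta)
open Literature.MathematicalPhysics.QuantumFieldTheory.Balaban1983to89.T4CouplingMatching (HistLipschitz FadingMemory ScaleShiftRate)
open Literature.MathematicalPhysics.QuantumFieldTheory.Balaban1983to89.T4BetaStationary (SeqBox betaInf MemoryProfile memoryProfile_betaInf)
open Summit.QuantumFields.BalabanUV.Beta.EriceFlowEnclosureB12AsPrintedHistoryContagionShiftFlowZero (exists_valueAtZero abs_sub_valueAtZero_le)
open Summit.QuantumFields.BalabanUV.Beta.EriceFlowEnclosureB12AsPrintedPointwiseFadingLimit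

noncomputable section

variable {β : HBeta} {γ C c θ : ℝ} {Λ : ℕ → ℕ → ℝ}

/-- **Prover 1's letter on the constant histories IS prover 2's displayed property.**  If β₀ carries part 32's value-at-zero letter for `B := betaInf β` — `|betaInf β u − β₀| ≤ C·Σ'_j θ^j u_j` for every
box history u (0 ≤ C, 0 ≤ θ < 1) — then `|betaInf β (u,u,…) − β₀| ≤ Cu∕(1−θ)` for every `u ∈ ]0, γ]` (their `abs_sub_valueAtZero_le` at the constant history). [folklore] -/
theorem hb_of_valueAtZero (hC : 0 ≤ C) (hθ0 : 0 ≤ θ) (hθ1 : θ < 1) {β₀ : ℝ}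
    (h0 : ∀ u : ℕ → ℝ, SeqBox γ u → |betaInf β u - β₀| ≤ C * ∑' j, θ ^ j * u j) :
    ∀ u : ℝ, 0 < u → u ≤ γ → |betaInf β (fun _ : ℕ => u) - β₀| ≤ C * u / (1 - θ) :=
  fun _ hu huγ => abs_sub_valueAtZero_le (B := betaInf β) hC hθ0 hθ1 h0 (seqBox_const hu huγ) fun _ => le_rfl

/-- **ONE NUMBER, TWO ROUTES: β₀ = b⋆.**  Any β₀ with part 32's letter for `betaInf β` and any b⋆ with part 11's property (same constant C, 0 ≤ θ < 1, 0 < γ) coincide (part 11's `bstar_unique`). [folklore] -/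
theorem valueAtZero_eq_bstar (hC : 0 ≤ C) (hθ0 : 0 ≤ θ) (hθ1 : θ < 1) (hγ : 0 < γ) {β₀ bstar : ℝ}
    (h0 : ∀ u : ℕ → ℝ, SeqBox γ u → |betaInf β u - β₀| ≤ C * ∑' j, θ ^ j * u j)
    (hb : ∀ u : ℝ, 0 < u → u ≤ γ → |betaInf β (fun _ : ℕ => u) - bstar| ≤ C * u / (1 - θ)) : β₀ = bstar :=
  bstar_unique hθ1 hC hγ (hb_of_valueAtZero hC hθ0 hθ1 h0) hb

/-- **b⋆ CARRIES PROVER 1's FULL LETTER.**  Under node U2's moduli `HistLipschitz Λ γ β` ∕ `FadingMemory C θ Λ` and NE4 `ScaleShiftRate c θ γ β` (0 ≤ θ < 1, 0 < γ), part 11's b⋆ satisfies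
`|betaInf β u − b⋆| ≤ C·Σ'_j θ^j u_j` for EVERY box history u — node U2's `memoryProfile_betaInf` makes `betaInf β` a fading-memory functional, prover 1's `exists_valueAtZero` supplies some β₀ with the
letter, and `valueAtZero_eq_bstar` identifies it with b⋆.  (Part 11's constant-history property alone does not control general histories; the memory profile does.) [folklore] -/
theorem valueAtZero_letter_bstar (hL : HistLipschitz Λ γ β) (hΛ : FadingMemory C θ Λ) (hS : ScaleShiftRate c θ γ β)
    (hθ0 : 0 ≤ θ) (hθ1 : θ < 1) (hγ : 0 < γ) {bstar : ℝ}
    (hb : ∀ u : ℝ, 0 < u → u ≤ γ → |betaInf β (fun _ : ℕ => u) - bstar| ≤ C * u / (1 - θ)) :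
    ∀ u : ℕ → ℝ, SeqBox γ u → |betaInf β u - bstar| ≤ C * ∑' j, θ ^ j * u j := by
  have hC : 0 ≤ C := T4BetaStationary.constant_nonneg_of_fadingMemory hΛ
  have hprof : MemoryProfile C θ γ (betaInf β) := memoryProfile_betaInf hS hL hΛ hθ0 hθ1
  obtain ⟨β₀, h0⟩ := exists_valueAtZero hprof hC hθ0 hθ1 hγ
  have heq : β₀ = bstar := valueAtZero_eq_bstar hC hθ0 hθ1 hγ h0 hb
  rw [← heq]
  exact h0

/-- Packaged: under the moduli + NE4 there is ONE real number carrying BOTH lineages' properties — prover 1's value-at-zero letter for `betaInf β` on all box histories AND prover 2's constant-history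
property — and it is unique for either. [folklore] -/
theorem exists_common_value (hL : HistLipschitz Λ γ β) (hΛ : FadingMemory C θ Λ) (hS : ScaleShiftRate c θ γ β)
    (hθ0 : 0 ≤ θ) (hθ1 : θ < 1) (hγ : 0 < γ) :
    ∃! b : ℝ, (∀ u : ℕ → ℝ, SeqBox γ u → |betaInf β u - b| ≤ C * ∑' j, θ ^ j * u j) ∧
      (∀ u : ℝ, 0 < u → u ≤ γ → |betaInf β (fun _ : ℕ => u) - b| ≤ C * u / (1 - θ)) := by
  have hC : 0 ≤ C := T4BetaStationary.constant_nonneg_of_fadingMemory hΛ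
  obtain ⟨bstar, hb⟩ := exists_bstar hL hΛ hS hθ0 hθ1 hC hγ
  refine ⟨bstar, ⟨valueAtZero_letter_bstar hL hΛ hS hθ0 hθ1 hγ hb, hb⟩, fun b' hb' => bstar_unique hθ1 hC hγ hb'.2 hb⟩

end

end Summit.QuantumFields.BalabanUV.Beta.EriceFlowEnclosureB12AsPrintedPointwiseFadingLimitZeroJunction
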